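import Summits.HodgeConjecture.CorCM.GaloisDihedralMirrorTypes
import Summits.HodgeConjecture.CorCM.CyclicAsymmetricCMHalves
import HarnessLib

/-!
# Galois CM fields with DIHEDRAL Galois group of order `4n`, `n ≥ 5`: primitive degenerate CM types, simple degenerate
# CM abelian varieties of dimension `2n`

COR-CM (cell `pub-hodgecm2`), binder seat b04 (gen 22), count-neutral claim GALOIS-DIHEDRAL, part III — the negative
side of the dihedral classification (part IV `CorCM/GaloisDihedralClassification`: GOOD ⟺ `n ≤ 4`).  KERNEL ONLY:
theorems; no definition, no named fact, no `sorry`.  `HC_CM` is neither used nor claimed.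

`G₀ =` Mathlib `DihedralGroup (2n)` (order `4n`).  For `n ≥ 2` its centre is `{1, rⁿ}`, so for a Galois CM field `K`
with `e : Gal(K/ℚ) ≃* DihedralGroup (2n)` complex conjugation is `e(c) = rⁿ` (§1 `map_complexConj_eq_r`).  The CM types
of `K` are the CM sets of `(G₀, rⁿ)`; the dihedral group has NO index-`2` subgroup avoiding `rⁿ` when `n` is even (no
imaginary quadratic subfield), and for odd `n` it is `D_n × C₂`.

* `n ≥ 6` (§2): the MIRROR TYPE (part I) of the explicit aperiodic asymmetric CM half
  `S(n) = {0, 1, 3, …, n−1} ∪ {n+2}` of `ℤ/2n` (part II) is PRIMITIVE and DEGENERATE — its Kubota rank is `n + 1` of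
  `2n + 1` (seat census, `scratch/g22c.py`, `n ≤ 12`; the kernel statement is degeneracy);
* `n = 5` (§2, order `20 = |D₅ × C₂|`): no asymmetric CM half of `ℤ/10` exists, and the degenerate primitive types
  (`200` of `720`, all of corank `1`) come from the odd linear character `r ↦ −1`; kernel certificate on
  `DihedralGroup 10` by `decide`: `T₀ = {r0,…,r4, sr0, sr1, sr3, sr4, sr7}`, balanced set `{r_{2i}} ⊔ {sr_{2i}}`;
* hence (§3 **`exists_simple_degenerate_of_mulEquiv_dihedral`**) for EVERY `n ≥ 5` a SIMPLE DEGENERATE abelian variety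
  of dimension `2n` with CM by `K`, with an exceptional Hodge class on some power (Shimura's existence theorem, Hazama's
  converse); `not_forall_isSimple_isNondegenerate_dihedral`.  For `n ≤ 4` (orders `4, 8, 12, 16`) every simple one is
  nondegenerate (part IV, by name from gens 13, 14, 16).

## References

* [Shimura1998] G. Shimura, *Abelian Varieties with Complex Multiplication and Modular Functions*, §6.2 Thm. 3,
  §8.2 Prop. 26, §18.2 Lemma (i).
* [Gordon1999HodgeAVSurvey] B. B. Gordon, *A survey of the Hodge conjecture for abelian varieties*, Thm. 6.4, §9.3.
* [Kubota1965] T. Kubota, Trans. AMS 118 (1965), §2.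
* [Dodson1984] B. Dodson, *The structure of Galois groups of CM-fields*, Trans. AMS 283 (1984), §3.3.1 (C), §4.1.
-/

noncomputable section

open CategoryTheory CategoryTheory.Limits NumberField
open scoped BigOperators

namespace Summit.HodgeConjecture.CorCM.GaloisDihedral

open Literature.NumberTheory.ComplexMultiplication
open Literature.AlgebraicGeometry.Motives (AbelianVariety CMType)
open Literature.AlgebraicGeometry.HodgeTheory
open Literature.AlgebraicGeometry.ComplexMultiplication (IsCMTypeRealisation)
open Literature.AlgebraicGeometry.Pohlmann1968
open Literature.Barriers.HodgeConjecture (divisorClassesSpan)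
open Summit.HodgeConjecture.CorCM.GaloisRank
open Summit.HodgeConjecture.CorCM.GaloisModels
open Summit.HodgeConjecture.CorCM.CyclicAsymmetricHalves
open DihedralGroup

/-! ## §1 The central involution of `DihedralGroup (2n)` -/

section Centre

variable {n : ℕ}

/-- **The only central involution of the dihedral group of order `4n` (`n ≥ 2`) is `rⁿ`.** [folklore] -/
theorem eq_r_of_central_involution (hn : 2 ≤ n) (x : DihedralGroup (2 * n)) (h1 : x * x = 1) (h2 : x ≠ 1)
    (h3 : ∀ y : DihedralGroup (2 * n), x * y = y * x) : x = r (n : ZMod (2 * n)) := by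
  haveI : NeZero n := ⟨by omega⟩
  rcases x with i | i
  · -- a rotation: `i + i = 0`, `i ≠ 0`
    rw [r_mul_r, one_def] at h1
    have hii : i + i = 0 := r.inj h1
    have hi0 : i ≠ 0 := fun h => h2 (by rw [h, r_zero])
    have hval := i.val_lt
    have hcast : ((i.val + i.val : ℕ) : ZMod (2 * n)) = 0 := by
      rw [Nat.cast_add, ZMod.natCast_zmod_val, hii]
    rw [ZMod.natCast_eq_zero_iff] at hcast
    obtain ⟨q, hq⟩ := hcast
    have hv0 : i.val ≠ 0 := fun h => hi0 ((ZMod.val_eq_zero i).1 h)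
    have hq1 : q = 1 := by
      rcases Nat.lt_or_ge q 2 with hq2 | hq2
      · interval_cases q <;> omega
      · nlinarith
    have hval' : i.val = n := by rw [hq1] at hq; omega
    congr 1
    rw [← ZMod.natCast_zmod_val i, hval']
  · -- a reflection is not central for `n ≥ 2`
    exfalso
    have h := h3 (r 1)
    rw [sr_mul_r, r_mul_sr] at h
    have h' : (1 : ZMod (2 * n)) + 1 = 0 := by
      have := sr.inj h
      linear_combination this
    have hcast : (((2 : ℕ)) : ZMod (2 * n)) = 0 := by
      rw [Nat.cast_ofNat]
      linear_combination h'
    rw [ZMod.natCast_eq_zero_iff] at hcast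
    have := Nat.le_of_dvd (by norm_num) hcast
    omega

variable {K : Type} [Field K] [NumberField K] [IsCMField K]

/-- **Complex conjugation is `rⁿ`** on any model `e : Gal(K/ℚ) ≃* DihedralGroup (2n)`, `n ≥ 2`.
[cite: Shimura1998, §18.2 Lemma (i)] -/
theorem map_complexConj_eq_r [IsGalois ℚ K] (hn : 2 ≤ n) (e : (K ≃ₐ[ℚ] K) ≃* DihedralGroup (2 * n)) :
    e ((IsCMField.complexConj K).restrictScalars ℚ) = r (n : ZMod (2 * n)) :=
  eq_r_of_central_involution hn _ (model_complexConj_mul_self e rfl) (model_complexConj_ne_one e rfl)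
    (model_complexConj_comm e rfl)

omit [IsCMField K] in
/-- `[K:ℚ] = 4n`. [folklore] -/
theorem finrank_eq_four_mul [IsGalois ℚ K] (e : (K ≃ₐ[ℚ] K) ≃* DihedralGroup (2 * n)) :
    Module.finrank ℚ K = 4 * n := by
  rw [← IsGalois.card_aut_eq_finrank, Nat.card_congr e.toEquiv, DihedralGroup.nat_card]
  ring

omit [IsCMField K] in
/-- `n ≠ 0`: the Galois group is finite, `DihedralGroup 0` is not. [folklore] -/
theorem pos_of_mulEquiv [IsGalois ℚ K] (e : (K ≃ₐ[ℚ] K) ≃* DihedralGroup (2 * n)) : 0 < n := by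
  have h := finrank_eq_four_mul e
  have := Module.finrank_pos (R := ℚ) (M := K)
  omega

end Centre

/-! ## §2 Primitive degenerate CM types: `n ≥ 6` by mirror types, `n = 5` by a certificate -/

section Types

variable {K : Type} [Field K] [NumberField K] [IsCMField K] [IsGalois ℚ K]

/-- **`n ≥ 6`: a primitive degenerate CM type** — the mirror type of the explicit asymmetric aperiodic CM half of
`ℤ/2n` (parts I–II). [cite: Shimura1998, §8.2 Prop. 26] [cite: Gordon1999HodgeAVSurvey, §9.3] -/
theorem exists_isPrimitive_not_isNondegenerate_dihedral_of_six_le {n : ℕ} (hn : 6 ≤ n)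
    (e : (K ≃ₐ[ℚ] K) ≃* DihedralGroup (2 * n)) (φ₀ : K →+* ℂ) :
    ∃ Φ : CMType K, IsPrimitive (ℂ ≃+* ℂ) Φ.1 φ₀ ∧ ¬ IsNondegenerate Φ := by
  haveI : NeZero n := ⟨by omega⟩
  obtain ⟨S, hS⟩ := exists_half n
  exact exists_isPrimitive_not_isNondegenerate_of_mirror e (n : ZMod (2 * n)) (map_complexConj_eq_r (by omega) e)
    S 0 (half_mem_iff_nat_add_not_mem (by omega) hS) (fun j hj => half_aperiodic hn hS hj)
    (half_asymmetric hn hS) φ₀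

/-- **`n ≥ 6`, realised: a simple degenerate abelian variety of dimension `2n` with CM by `K`** and an exceptional
Hodge class on some power. [cite: Shimura1998, §6.2 Thm. 3 and §8.2 Prop. 26] [cite: Gordon1999HodgeAVSurvey, Thm. 6.4] -/
theorem exists_simple_degenerate_dihedral_of_six_le {n : ℕ} (hn : 6 ≤ n)
    (e : (K ≃ₐ[ℚ] K) ≃* DihedralGroup (2 * n)) :
    ∃ (Φ : CMType K) (φ₀ : K →+* ℂ) (A : AbelianVariety ℂ) (ι : 𝓞 K →+* End A)
      (θ : K →+* Module.End ℂ (complexBetti A.X 1)),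
      IsPrimitive (ℂ ≃+* ℂ) Φ.1 φ₀ ∧ ¬ IsNondegenerate Φ ∧ IsCMTypeRealisation Φ A ι θ ∧ A.IsSimple ∧
      A.dim = 2 * n ∧
      ∃ N p : ℕ, ∃ x : complexBetti (⨁ fun _ : Fin N => A).X (2 * p), IsRationalClass x ∧
        IsOfHodgeType (⨁ fun _ : Fin N => A).dim (⨁ fun _ : Fin N => A).X (2 * p) p p x ∧
        x ∉ divisorClassesSpan (⨁ fun _ : Fin N => A).X (⨁ fun _ : Fin N => A).dim p := by
  haveI : NeZero n := ⟨by omega⟩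
  obtain ⟨S, hS⟩ := exists_half n
  exact exists_simple_degenerate_of_mirror e (n : ZMod (2 * n)) (map_complexConj_eq_r (by omega) e) S 0
    (half_mem_iff_nat_add_not_mem (by omega) hS) (fun j hj => half_aperiodic hn hS hj) (half_asymmetric hn hS)

/-- **`n = 5` (order `20`): a primitive degenerate CM type by a kernel-decided certificate** on `DihedralGroup 10`
(`c = r⁵`; `T₀ = {r0,…,r4, sr0, sr1, sr3, sr4, sr7}`, balanced set the even rotations and even reflections: the
odd linear character `r ↦ −1, s ↦ 1` vanishes on `T₀`). [cite: Shimura1998, §8.2 Prop. 26] [cite: Gordon1999HodgeAVSurvey, §9.3] -/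
theorem exists_isPrimitive_not_isNondegenerate_dihedral_ten (e : (K ≃ₐ[ℚ] K) ≃* DihedralGroup 10)
    (φ₀ : K →+* ℂ) : ∃ Φ : CMType K, IsPrimitive (ℂ ≃+* ℂ) Φ.1 φ₀ ∧ ¬ IsNondegenerate Φ := by
  have hc : e ((IsCMField.complexConj K).restrictScalars ℚ) = r 5 := by
    have h := map_complexConj_eq_r (n := 5) (by norm_num) e
    simpa using h
  exact exists_isPrimitive_not_isNondegenerate_of_model_balanced e (r 5) hc
    {r 0, r 1, r 2, r 3, r 4, sr 0, sr 1, sr 3, sr 4, sr 7} (by decide) (by decide)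
    {r 0, r 2, r 4, r 6, r 8, sr 0, sr 2, sr 4, sr 6, sr 8} (by decide) (by decide) φ₀

/-- **`n = 5`, realised: a simple degenerate abelian 10-fold with CM by `K`** (Galois group `D₁₀ ≅ D₅ × C₂` of order
`20`) and an exceptional Hodge class on some power. [cite: Shimura1998, §6.2 Thm. 3 and §8.2 Prop. 26]
[cite: Gordon1999HodgeAVSurvey, Thm. 6.4] -/
theorem exists_simple_degenerate_dihedral_ten (e : (K ≃ₐ[ℚ] K) ≃* DihedralGroup 10) :
    ∃ (Φ : CMType K) (φ₀ : K →+* ℂ) (A : AbelianVariety ℂ) (ι : 𝓞 K →+* End A)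
      (θ : K →+* Module.End ℂ (complexBetti A.X 1)),
      IsPrimitive (ℂ ≃+* ℂ) Φ.1 φ₀ ∧ ¬ IsNondegenerate Φ ∧ IsCMTypeRealisation Φ A ι θ ∧ A.IsSimple ∧
      A.dim = 10 ∧
      ∃ N p : ℕ, ∃ x : complexBetti (⨁ fun _ : Fin N => A).X (2 * p), IsRationalClass x ∧
        IsOfHodgeType (⨁ fun _ : Fin N => A).dim (⨁ fun _ : Fin N => A).X (2 * p) p p x ∧
        x ∉ divisorClassesSpan (⨁ fun _ : Fin N => A).X (⨁ fun _ : Fin N => A).dim p := by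
  have hc : e ((IsCMField.complexConj K).restrictScalars ℚ) = r 5 := by
    have h := map_complexConj_eq_r (n := 5) (by norm_num) e
    simpa using h
  have h := exists_simple_degenerate_of_model_balanced e (r 5) hc
    {r 0, r 1, r 2, r 3, r 4, sr 0, sr 1, sr 3, sr 4, sr 7} (by decide) (by decide)
    {r 0, r 2, r 4, r 6, r 8, sr 0, sr 2, sr 4, sr 6, sr 8} (by decide) (by decide)
  rwa [DihedralGroup.card] at h

/-! ## §3 Every `n ≥ 5` -/

/-- **THEOREM (type level).  `Gal(K/ℚ) ≅ DihedralGroup (2n)` (order `4n`) with `n ≥ 5`: `K` has a PRIMITIVE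
DEGENERATE CM type.** [cite: Shimura1998, §8.2 Prop. 26] [cite: Kubota1965, §2] [cite: Gordon1999HodgeAVSurvey, §9.3] -/
theorem exists_isPrimitive_not_isNondegenerate_dihedral {n : ℕ} (hn : 5 ≤ n)
    (e : (K ≃ₐ[ℚ] K) ≃* DihedralGroup (2 * n)) (φ₀ : K →+* ℂ) :
    ∃ Φ : CMType K, IsPrimitive (ℂ ≃+* ℂ) Φ.1 φ₀ ∧ ¬ IsNondegenerate Φ := by
  rcases (show n = 5 ∨ 6 ≤ n by omega) with rfl | h6
  · exact exists_isPrimitive_not_isNondegenerate_dihedral_ten e φ₀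
  · exact exists_isPrimitive_not_isNondegenerate_dihedral_of_six_le h6 e φ₀

/-- **THEOREM.  `Gal(K/ℚ) ≅ DihedralGroup (2n)` (dihedral of order `4n`) with `n ≥ 5`: there is a SIMPLE DEGENERATE
abelian variety of dimension `2n` with complex multiplication by `K`**, carrying on some power a rational `(p,p)` class
outside the complexified divisor ring (an exceptional Hodge class). [cite: Shimura1998, §6.2 Thm. 3 and §8.2 Prop. 26]
[cite: Gordon1999HodgeAVSurvey, Thm. 6.4] [cite: Dodson1984, §3.3.1 (C)] -/
theorem exists_simple_degenerate_of_mulEquiv_dihedral {n : ℕ} (hn : 5 ≤ n)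
    (e : (K ≃ₐ[ℚ] K) ≃* DihedralGroup (2 * n)) :
    ∃ (Φ : CMType K) (φ₀ : K →+* ℂ) (A : AbelianVariety ℂ) (ι : 𝓞 K →+* End A)
      (θ : K →+* Module.End ℂ (complexBetti A.X 1)),
      IsPrimitive (ℂ ≃+* ℂ) Φ.1 φ₀ ∧ ¬ IsNondegenerate Φ ∧ IsCMTypeRealisation Φ A ι θ ∧ A.IsSimple ∧
      A.dim = 2 * n ∧
      ∃ N p : ℕ, ∃ x : complexBetti (⨁ fun _ : Fin N => A).X (2 * p), IsRationalClass x ∧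
        IsOfHodgeType (⨁ fun _ : Fin N => A).dim (⨁ fun _ : Fin N => A).X (2 * p) p p x ∧
        x ∉ divisorClassesSpan (⨁ fun _ : Fin N => A).X (⨁ fun _ : Fin N => A).dim p := by
  rcases (show n = 5 ∨ 6 ≤ n by omega) with rfl | h6
  · exact exists_simple_degenerate_dihedral_ten e
  · exact exists_simple_degenerate_dihedral_of_six_le h6 e

/-- **Corollary: for `n ≥ 5` it is FALSE that every simple abelian variety with CM by `K` is nondegenerate.**
[cite: Shimura1998, §8.2 Prop. 26] [cite: Gordon1999HodgeAVSurvey, Thm. 6.4] -/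
theorem not_forall_isSimple_isNondegenerate_dihedral {n : ℕ} (hn : 5 ≤ n)
    (e : (K ≃ₐ[ℚ] K) ≃* DihedralGroup (2 * n)) :
    ¬ ∀ (Φ : CMType K) (A : AbelianVariety ℂ) (ι : 𝓞 K →+* End A) (θ : K →+* Module.End ℂ (complexBetti A.X 1)),
      IsCMTypeRealisation Φ A ι θ → A.IsSimple → IsNondegenerate Φ := by
  intro hall
  obtain ⟨Φ, φ₀, A, ι, θ, -, hdeg, hA, hs, -, -⟩ := exists_simple_degenerate_of_mulEquiv_dihedral hn e
  exact hdeg (hall Φ A ι θ hA hs)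

end Types

end Summit.HodgeConjecture.CorCM.GaloisDihedral

end
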